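import Literature.MathematicalPhysics.QuantumFieldTheory.Balaban1983to89.Node00.SmallFieldChi29AxOfRecord
import Literature.MathematicalPhysics.QuantumFieldTheory.Balaban1983to89.T4AdjointCovarianceUnitary
import Literature.MathematicalPhysics.QuantumFieldTheory.Balaban1983to89.MatrixLog
import Summits.QuantumFields.YangMills.Theorems.BalabanUVNodesK0RecordFormatNames

/-!
# NODE O port PT-A — `stub_FE`, brick (h1) of FE-SPLIT-PROPOSAL-v1 §3: THE (2.9) CUT-OFF IN THE CHART VARIABLE — in print's chart `V(b) = exp(iB′(b))·V^{(k)}_{ax}(W)(b)` ([I] (2.4))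
# the record's axial-centred fluctuation deviation is `|V^{(k)}_{ax}(b)⁻¹V(b) − 1| = ‖exp(iB′(b)) − 1‖`, and `(2∕π)‖B′(b)‖ ≤ ‖exp(iB′(b)) − 1‖ ≤ ‖B′(b)‖` ([12] (24)–(25)) — so the record's
# cut-off `chiFix29AxOfRecord` ([I] (2.9), an indicator of `dist1 < ε₁` off `b₀`) is squeezed between the two chart-variable cut-offs `‖B′(b)‖ < ε₁` and `‖B′(b)‖ < (2∕π)ε₁`

Cell `ym-nodeO-ideate`, porter seat `ymgap-nodeO-port-PTA-1` (gen 7, lead of the line `pta-residueW`); `--supports stmt-QuantumFields-27930` (helper; brick of (FE-1) `stub_FEsplit` = [I] (2.12) at the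
record, whose prerequisite carrier `recordFluctInt` (★★ DEF-1, `B12Eq216GaussianCarrier.onBonds…`) reads the cut-off as `‖B′(b)‖ < ε₁` in the chart variable, while the record's (2.1)∕(2.9)
objects (`Node00/SmallFieldChi29AxOfRecord.chiFix29AxOfRecord`, PTA-2) read `dist1 (V^{(k)}_{ax}(V̄)(b)⁻¹ · V(b)) < ε₁` — THIS FILE is the dictionary between the two).
[I] = [Balaban1987RG1] (2.4), (2.9) p.266; [12] = [Balaban1985Averaging] (24)–(25) p.21.
CONSUMED BY NAME: `Node00.fluctDevAxOfRecord_apply`, `chiFix29AxOfRecord_eq_one_iff` (PTA-2, p796675), `GaugeGroup.dist1_conj`, `Node00.dist1_su_eq_norm`-shape (`rfl`),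
`T4AdjointCovarianceUnitary.expSU ∕ coe_expSU ∕ mem_lieSU_iff`, `MatrixLog.opDist1_exp_le` ((24)), `MatrixLog.norm_le_pi_div_two_mul_opDist1_exp` ((25)), at `A := −iX`.
* §1 (any `SU(n)`): `dist1_inv_mul_expSU_mul` (`dist1 (g⁻¹·(expSU X·g)) = ‖exp X − 1‖`), `norm_exp_sub_one_le_of_lieSU` (`≤ ‖X‖`), `norm_le_pi_div_two_mul_norm_exp_sub_one_of_lieSU` (`‖X‖ ≤ (π∕2)‖exp X − 1‖` for
  `‖X‖ ≤ π`).
* §2 (at the record): ★ `fluctDevAxOfRecord_expChart` (the deviation of `V = expSU X · V^{(k)}_{ax}(W)` on the fibre `V̄ = W` IS `‖exp X(b) − 1‖`), ★★ `chiFix29AxOfRecord_eq_one_iff_expChart`,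
  ★ `chiFix29AxOfRecord_eq_one_of_norm_lt` (`‖X(b)‖ < ε₁` off `b₀` ⇒ `χ = 1`), ★ `norm_lt_of_chiFix29AxOfRecord_eq_one` (`χ = 1` ⇒ `‖X(b)‖ < (π∕2)ε₁` off `b₀`, for `‖X(b)‖ ≤ π`).

HONEST FRAMING.  A dictionary lemma (C⋆-algebra facts of the tree + the record's definitions); NOTHING of Bałaban's estimates asserted, ported or discharged; `stub_FE` XXL and `stub_LZdet` (P0-ℂ)
OPEN; 27930 ⁸-Ax-LR4 OPEN · 2∕4 stubs · no claim; NODE O 0∕1; COUNT 8∕28 · K 1∕4 UNMOVED; finite `𝕋⁴_{L^K}` at fixed ε — NOT continuum ∕ OS ∕ Clay; **the Yang–Mills mass gap is NOT proved by any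
of this.**  No `sorry`, no `def`, no `instance`, no `notation`; standard axioms.
-/

noncomputable section

open scoped Matrix.Norms.L2Operator

namespace Summit.QuantumFields.YangMills.Theorems.BalabanUVNodesPortS1

open Literature.MathematicalPhysics.QuantumFieldTheory.Balaban1983to89
open Literature.MathematicalPhysics.QuantumFieldTheory.Balaban1983to89.Node00
open Literature.MathematicalPhysics.QuantumFieldTheory.Balaban1983to89.T4Continuum (T4Family)
open Literature.MathematicalPhysics.QuantumFieldTheory.Balaban1983to89.T4AdjointCovarianceUnitary (lieSU mem_lieSU_iff expSU coe_expSU)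
open _root_.Matrix

/-! ## §1  `SU(n)`: the deviation of a conjugated exponential and the two-sided window (24)–(25) -/

section SU

variable {n : Type} [Fintype n] [DecidableEq n]

omit [DecidableEq n] in
/-- For `X ∈ 𝔰𝔲(n)`, `A := −i·X` is Hermitian and `i·A = X` (the chart variable of [12] (24)–(25) is `A`). [folklore] -/
theorem isHermitian_neg_I_smul_of_lieSU (X : lieSU n) :
    (-(Complex.I • (X : Matrix n n ℂ))).IsHermitian ∧ Complex.I • (-(Complex.I • (X : Matrix n n ℂ))) = (X : Matrix n n ℂ) := by
  have hskew : star (X : Matrix n n ℂ) = -(X : Matrix n n ℂ) := (mem_lieSU_iff.1 X.2).1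
  refine ⟨?_, ?_⟩
  · show star (-(Complex.I • (X : Matrix n n ℂ))) = -(Complex.I • (X : Matrix n n ℂ))
    rw [star_neg, star_smul, hskew, Complex.star_def, Complex.conj_I, smul_neg, neg_neg, neg_smul]
  · rw [smul_neg, smul_smul, Complex.I_mul_I, neg_smul, one_smul, neg_neg]

/-- `‖−i·X‖ = ‖X‖`. [folklore] -/
theorem norm_neg_I_smul (X : Matrix n n ℂ) : ‖-(Complex.I • X)‖ = ‖X‖ := by
  rw [norm_neg, norm_smul, Complex.norm_I, one_mul]

/-- **(24)**: `‖exp X − 1‖ ≤ ‖X‖` for `X ∈ 𝔰𝔲(n)` (operator norm; `MatrixLog.opDist1_exp_le` at `A = −iX`). [cite: Balaban1985Averaging, (24) p.21] -/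
theorem norm_exp_sub_one_le_of_lieSU (X : lieSU n) : ‖NormedSpace.exp (X : Matrix n n ℂ) - 1‖ ≤ ‖(X : Matrix n n ℂ)‖ := by
  obtain ⟨hA, hIA⟩ := isHermitian_neg_I_smul_of_lieSU X
  have h := MatrixLog.opDist1_exp_le hA
  rw [hIA, UnitaryModel.opDist1, norm_neg_I_smul] at h
  exact h

/-- **(25)**: `‖X‖ ≤ (π∕2)·‖exp X − 1‖` for `X ∈ 𝔰𝔲(n)` with `‖X‖ ≤ π` (`MatrixLog.norm_le_pi_div_two_mul_opDist1_exp` at `A = −iX`). [cite: Balaban1985Averaging, (25) p.21] -/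
theorem norm_le_pi_div_two_mul_norm_exp_sub_one_of_lieSU (X : lieSU n) (hX : ‖(X : Matrix n n ℂ)‖ ≤ Real.pi) :
    ‖(X : Matrix n n ℂ)‖ ≤ Real.pi / 2 * ‖NormedSpace.exp (X : Matrix n n ℂ) - 1‖ := by
  obtain ⟨hA, hIA⟩ := isHermitian_neg_I_smul_of_lieSU X
  have h := MatrixLog.norm_le_pi_div_two_mul_opDist1_exp hA (by rw [norm_neg_I_smul]; exact hX)
  rw [hIA, UnitaryModel.opDist1, norm_neg_I_smul] at h
  exact h

variable [Nonempty n]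

/-- **THE DEVIATION OF A CONJUGATED EXPONENTIAL**: `dist1 (g⁻¹ · (expSU X · g)) = ‖exp X − 1‖` in `SU(n)` (`dist1` is conjugation invariant and `dist1 h = ‖↑h − 1‖`).
[cite: Balaban1987RG1, (2.4) p.266, (2.9) p.266 (bookkeeping)] -/
theorem dist1_inv_mul_expSU_mul (g : Matrix.specialUnitaryGroup n ℂ) (X : lieSU n) :
    dist1 (g⁻¹ * (expSU X * g)) = ‖NormedSpace.exp (X : Matrix n n ℂ) - 1‖ := by
  have hconj : g⁻¹ * (expSU X * g) = g⁻¹ * expSU X * (g⁻¹)⁻¹ := by rw [inv_inv, mul_assoc]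
  rw [hconj, GaugeGroup.dist1_conj]
  show ‖((expSU X : Matrix.specialUnitaryGroup n ℂ) : Matrix n n ℂ) - 1‖ = _
  rw [coe_expSU]

end SU

/-! ## §2  At the record: the (2.9) cut-off in the chart variable -/

section Record

variable (F : T4Family) (N : ℕ) [NeZero N]

/-- ★ **THE AXIAL-CENTRED FLUCTUATION DEVIATION IN PRINT's CHART**: on the fibre `V̄ = W`, for `V(b) = expSU (X b) · V^{(k)}_{ax}(W)(b)`, `|V^{(k)}_{ax}(V̄)(b)⁻¹ V(b) − 1| = ‖exp X(b) − 1‖`.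
[cite: Balaban1987RG1, (2.4) p.266, (2.9) p.266] -/
theorem fluctDevAxOfRecord_expChart (ν : Stage7Numerics) (K k : ℕ) (W : GaugeField (F.P K) (k + 1) (SU N)) (X : PBond (F.P K) k → lieSU (Fin N))
    (V : GaugeField (F.P K) k (SU N)) (hV : ∀ b, V b = expSU (X b) * critCfgAxOfRecord F N ν K k W b) (havg : (avOfRecord F N K k).avg V = W)
    (b : PBond (F.P K) k) :
    fluctDevAxOfRecord F N ν K k V b = ‖NormedSpace.exp (X b : Matrix (Fin N) (Fin N) ℂ) - 1‖ := by
  rw [fluctDevAxOfRecord_apply, havg, hV b]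
  exact dist1_inv_mul_expSU_mul _ _

/-- ★★ **THE (2.9) CUT-OFF IN THE CHART VARIABLE**: on the fibre `V̄ = W`, for `V = expSU X · V^{(k)}_{ax}(W)`, `χ^{(2.9)}_{k,ax}(V) = 1 ↔ ∀ b ∉ b₀, ‖exp X(b) − 1‖ < ε₁`.
[cite: Balaban1987RG1, (2.9) p.266] -/
theorem chiFix29AxOfRecord_eq_one_iff_expChart (ν : Stage7Numerics) (ε₁ : ℝ) (K k : ℕ) (W : GaugeField (F.P K) (k + 1) (SU N))
    (X : PBond (F.P K) k → lieSU (Fin N)) (V : GaugeField (F.P K) k (SU N)) (hV : ∀ b, V b = expSU (X b) * critCfgAxOfRecord F N ν K k W b)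
    (havg : (avOfRecord F N K k).avg V = W) :
    chiFix29AxOfRecord F N ν ε₁ K k V = 1 ↔ ∀ b : PBond (F.P K) k, ¬ IsB0 b → ‖NormedSpace.exp (X b : Matrix (Fin N) (Fin N) ℂ) - 1‖ < ε₁ := by
  rw [chiFix29AxOfRecord_eq_one_iff]
  refine forall_congr' fun b => imp_congr_right fun _ => ?_
  rw [fluctDevAxOfRecord_expChart F N ν K k W X V hV havg b]

/-- ★ **THE CHART CUT-OFF IMPLIES THE RECORD's**: `‖X(b)‖ < ε₁` off `b₀` ⇒ `χ^{(2.9)}_{k,ax}(V) = 1` (by (24)). [cite: Balaban1987RG1, (2.9) p.266; Balaban1985Averaging, (24) p.21] -/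
theorem chiFix29AxOfRecord_eq_one_of_norm_lt (ν : Stage7Numerics) (ε₁ : ℝ) (K k : ℕ) (W : GaugeField (F.P K) (k + 1) (SU N))
    (X : PBond (F.P K) k → lieSU (Fin N)) (V : GaugeField (F.P K) k (SU N)) (hV : ∀ b, V b = expSU (X b) * critCfgAxOfRecord F N ν K k W b)
    (havg : (avOfRecord F N K k).avg V = W) (hX : ∀ b : PBond (F.P K) k, ¬ IsB0 b → ‖(X b : Matrix (Fin N) (Fin N) ℂ)‖ < ε₁) :
    chiFix29AxOfRecord F N ν ε₁ K k V = 1 :=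
  (chiFix29AxOfRecord_eq_one_iff_expChart F N ν ε₁ K k W X V hV havg).2 fun b hb => (norm_exp_sub_one_le_of_lieSU (X b)).trans_lt (hX b hb)

/-- ★ **THE RECORD's CUT-OFF IMPLIES THE ENLARGED CHART CUT-OFF**: `χ^{(2.9)}_{k,ax}(V) = 1` ⇒ `‖X(b)‖ < (π∕2)ε₁` off `b₀`, for chart variables with `‖X(b)‖ ≤ π` (by (25)).
[cite: Balaban1987RG1, (2.9) p.266; Balaban1985Averaging, (25) p.21] -/
theorem norm_lt_of_chiFix29AxOfRecord_eq_one (ν : Stage7Numerics) (ε₁ : ℝ) (K k : ℕ) (W : GaugeField (F.P K) (k + 1) (SU N))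
    (X : PBond (F.P K) k → lieSU (Fin N)) (V : GaugeField (F.P K) k (SU N)) (hV : ∀ b, V b = expSU (X b) * critCfgAxOfRecord F N ν K k W b)
    (havg : (avOfRecord F N K k).avg V = W) (hπ : ∀ b : PBond (F.P K) k, ‖(X b : Matrix (Fin N) (Fin N) ℂ)‖ ≤ Real.pi)
    (hχ : chiFix29AxOfRecord F N ν ε₁ K k V = 1) :
    ∀ b : PBond (F.P K) k, ¬ IsB0 b → ‖(X b : Matrix (Fin N) (Fin N) ℂ)‖ < Real.pi / 2 * ε₁ := by
  intro b hb
  have h := (chiFix29AxOfRecord_eq_one_iff_expChart F N ν ε₁ K k W X V hV havg).1 hχ b hb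
  exact (norm_le_pi_div_two_mul_norm_exp_sub_one_of_lieSU (X b) (hπ b)).trans_lt (by
    have hpos : (0 : ℝ) < Real.pi / 2 := by positivity
    exact mul_lt_mul_of_pos_left h hpos)

end Record

end Summit.QuantumFields.YangMills.Theorems.BalabanUVNodesPortS1

end
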